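import Summits.HodgeConjecture.HodgeConjecture.Theorems.CyclicUnitaryPowersJacobianEigenparts

/-!
# Eigen-parts of the Jacobian ring of `x₃^p − f` under the covering group:
# `dim (R_F^k)_{ζ^i} = dim R_f^{k+1−i}` (route `CyclicUnitaryPowers`, item stmt-HodgeConjecture-19544; helper)

Helper file for crux K1 `VeryGeneralDeckCommutatorsInHg` of route
`route-HodgeConjecture-CyclicUnitaryPowers` (cell `hodge-nonav`), landed
`--supports stmt-HodgeConjecture-19544`. Prover seat `hodge-nonav-prover-Bx` (g5), 2026-08-27.
Sorry-free, no definition, no named fact. Sequel of `CyclicUnitaryPowersJacobianEigenparts`;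
consumed by `CyclicUnitaryPowersDeckHodgeOfGriffiths`.

THE COUNT (Carlson–Toledo 1999 §5, the commutative algebra behind "the corresponding space of
numerator polynomials [`y^{i−1}A(x)`], taken modulo the Jacobian ideal of `P`, is isomorphic via the
residue map to `H^{p,q}_0(i)`"): for `F = x₃^p − f`, `a = (1,1,1,ζ)`, `ζ = e^{2πi/p}`, `1 ≤ i ≤ p − 1`
and every degree `k`,

  `dim_ℂ (S₄^k)_{ζ^i} − dim_ℂ (J_F^k)_{ζ^i} = dim_ℂ S₃^{k+1−i} − dim_ℂ J_f^{k+1−i}`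

(`= dim R_f^{k+1−i}`; and `= 0` if `k + 1 < i`), the `ζ^i`-parts being those of the twisted action
`T_a` (`twistedDiagonalAction`). Proof: the coefficient-of-`x₃^{i−1}` map `ψ : S₄ → S₃` sends
`(S₄^k)_{ζ^i}` ONTO `S₃^{k+1−i}` and `(J_F^k)_{ζ^i}` ONTO `J_f^{k+1−i}` (section `A ↦ A x₃^{i−1}`;
`J_f x₃^{i−1} ⊆ J_F`; the `x₃^{i−1}`-coefficient of an element of `J_F` lies in `J_f` as
`i − 1 ≤ p − 2`), and a `ζ^i`-eigenform killed by `ψ` is supported on monomials with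
`e₃ ≥ p − 1`, hence lies in `J_F`: so both restrictions of `ψ` have the same kernel, and rank–nullity
gives the difference (`finrank_eigenpart_sub_finrank_eigenpart_jacobianIdeal`).

## References

* [CarlsonToledo1999] J. A. Carlson, D. Toledo, Discriminant complements and kernels of monodromy
  representations, Duke Math. J. 97 (1999); arXiv alg-geom/9708002, §5 (held text p0011–p0012).
* [VoisinHodgeII2003] C. Voisin, Hodge Theory and Complex Algebraic Geometry II, CUP 2003, §6.1.3
  Cor. 6.12.
-/

noncomputable section

-- mandated namespace `Summit.HodgeConjecture.HodgeConjecture.Theorems` trips `linter.dupNamespace` (off tree-wide)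
set_option linter.dupNamespace false

namespace Summit.HodgeConjecture.HodgeConjecture.Theorems.CyclicUnitaryPowersJacobianEigenpartsCount

open scoped Polynomial
open Literature.AlgebraicGeometry.Motives Literature.AlgebraicGeometry.HodgeTheory
open Literature.RingTheory.MvPolynomial (idealDegree mem_idealDegree)
open Summit.HodgeConjecture.HodgeConjecture.Theorems.CyclicUnitaryPowersJacobianEigenparts
open MvPolynomial

variable {p : ℕ}

/-- **No `ζ^i`-eigenforms of degree `k < i − 1`**: a `ζ^i`-eigen-monomial of degree `k` has
`x₃`-degree `i − 1 ≤ k` or `≥ p − 1 > k`. [cite: CarlsonToledo1999, §5 (held text p0011)] -/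
theorem eigenspace_inf_homogeneousSubmodule_eq_bot (hp : 2 ≤ p) {i k : ℕ} (hip : i < p) (hki : k + 1 < i) :
    Module.End.eigenspace (twistedDiagonalAction (deckUnit p))
        (Complex.exp (2 * (Real.pi : ℂ) * Complex.I / (p : ℂ)) ^ i) ⊓ homogeneousSubmodule (Fin 4) ℂ k = ⊥ := by
  refine eq_bot_iff.mpr ?_
  rintro P ⟨hPE, hPk⟩
  rw [SetLike.mem_coe, mem_eigenspace_twistedDiagonalAction_iff] at hPE
  rw [Submodule.mem_bot]
  by_contra hP0
  obtain ⟨e, he⟩ := exists_coeff_ne_zero hP0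
  have hdeg : e.degree = k := by
    by_contra hne
    exact he (((mem_homogeneousSubmodule k P).mp hPk).coeff_eq_zero hne)
  have hle : e (Fin.last 3) ≤ k := hdeg ▸ Finsupp.le_degree (Fin.last 3) e
  have h := le_last_of_diagonalCharacter_eq hp hip (hPE e (mem_support_iff.mpr he)) (by omega)
  omega

/-- **`dim (S₄^k)_{ζ^i} − dim (J_F^k)_{ζ^i} = dim S₃^{k+1−i} − dim J_f^{k+1−i}`** for `F = x₃^p − f`,
the deck unit `a = (1,1,1,ζ)` and `1 ≤ i ≤ p − 1` (and `0 = 0` below the range `k + 1 < i`):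
the eigen-Hilbert function of the Jacobian ring of the cyclic cover is the Hilbert function of the
Jacobian ring of the branch form, shifted by the `x₃`-degree `i − 1` of the numerators
`x₃^{i−1}A(x₀,x₁,x₂)` — the commutative algebra of Carlson–Toledo §5 ("Residues with numerator
`y^{i−1}A(x)` […] span `H^{p,q}_0(i)` […] the corresponding space of numerator polynomials, taken
modulo the Jacobian ideal of `P`, is isomorphic via the residue map to `H^{p,q}_0(i)`"). Proof by the
coefficient-of-`x₃^{i−1}` map and rank–nullity (module docstring).
[cite: CarlsonToledo1999, §5 (held text p0011–p0012)] -/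
theorem finrank_eigenpart_sub_finrank_eigenpart_jacobianIdeal (hp : 2 ≤ p) (f : MvPolynomial (Fin 3) ℂ)
    {i : ℕ} (hi1 : 1 ≤ i) (hip : i < p) (k : ℕ) :
    Module.finrank ℂ ↥(Module.End.eigenspace (twistedDiagonalAction (deckUnit p))
          (Complex.exp (2 * (Real.pi : ℂ) * Complex.I / (p : ℂ)) ^ i) ⊓ homogeneousSubmodule (Fin 4) ℂ k) -
      Module.finrank ℂ ↥(Module.End.eigenspace (twistedDiagonalAction (deckUnit p))
          (Complex.exp (2 * (Real.pi : ℂ) * Complex.I / (p : ℂ)) ^ i) ⊓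
        idealDegree (UniversalHypersurface.jacobianIdeal (cyclicCoverForm p f)) k) =
    if k + 1 < i then 0 else
      Module.finrank ℂ ↥(homogeneousSubmodule (Fin 3) ℂ (k + 1 - i)) -
        Module.finrank ℂ ↥(idealDegree (UniversalHypersurface.jacobianIdeal f) (k + 1 - i)) := by
  classical
  set ζ := Complex.exp (2 * (Real.pi : ℂ) * Complex.I / (p : ℂ)) with hζ
  set T := twistedDiagonalAction (deckUnit p) with hT
  set JF := UniversalHypersurface.jacobianIdeal (cyclicCoverForm p f) with hJF
  set Jf := UniversalHypersurface.jacobianIdeal f with hJf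
  set Sk := homogeneousSubmodule (Fin 4) ℂ k with hSk
  set V := Module.End.eigenspace T (ζ ^ i) ⊓ Sk with hV
  set W := Module.End.eigenspace T (ζ ^ i) ⊓ idealDegree JF k with hW
  have hWV : W ≤ V := inf_le_inf_left _ inf_le_right
  haveI : Module.Finite ℂ ↥Sk := Module.Finite.iff_fg.mpr (homogeneousSubmodule_fg (Fin 4) ℂ k)
  haveI : FiniteDimensional ℂ ↥V := Submodule.finiteDimensional_inf_right _ _
  haveI : FiniteDimensional ℂ ↥W := Submodule.finiteDimensional_of_le hWV
  split_ifs with hki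
  · -- below the range: no eigenforms at all
    have hV0 : V = ⊥ := eigenspace_inf_homogeneousSubmodule_eq_bot hp hip hki
    have hW0 : W = ⊥ := le_bot_iff.mp (hV0 ▸ hWV)
    rw [hV0, hW0, finrank_bot]
  · -- `m = i - 1 ≤ k`: the coefficient of `x₃^m`
    set m := i - 1 with hm
    have hmk : m ≤ k := by omega
    have hkm : k + 1 - i = k - m := by omega
    have hm1 : m + 1 < p := by omega
    have hmi : m + 1 = i := by omega
    set ψ : MvPolynomial (Fin 4) ℂ →ₗ[ℂ] MvPolynomial (Fin 3) ℂ :=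
      ((Polynomial.lcoeff (MvPolynomial (Fin 3) ℂ) m).restrictScalars ℂ) ∘ₗ
        (((MvPolynomial.optionEquivLeft ℂ (Fin 3)).toAlgHom.comp (rename finSuccEquivLast)).toLinearMap)
      with hψdef
    have hψ : ∀ P, ψ P = (MvPolynomial.optionEquivLeft ℂ (Fin 3) (rename finSuccEquivLast P)).coeff m :=
      fun P ↦ rfl
    -- the section `A ↦ A x₃^m`
    have hsecE : ∀ A : MvPolynomial (Fin 3) ℂ,
        rename Fin.castSucc A * X (Fin.last 3) ^ m ∈ Module.End.eigenspace T (ζ ^ i) := by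
      intro A
      have h := rename_castSucc_mul_X_last_pow_mem_eigenspace p A m
      rwa [hmi] at h
    have hsecS : ∀ A ∈ homogeneousSubmodule (Fin 3) ℂ (k - m),
        (rename Fin.castSucc A * X (Fin.last 3) ^ m : MvPolynomial (Fin 4) ℂ) ∈ Sk := by
      intro A hA
      rw [hSk, mem_homogeneousSubmodule]
      have h := isHomogeneous_rename_castSucc_mul_X_last_pow ((mem_homogeneousSubmodule _ A).mp hA) m
      rwa [Nat.sub_add_cancel hmk] at h
    have hψsec : ∀ A : MvPolynomial (Fin 3) ℂ, ψ (rename Fin.castSucc A * X (Fin.last 3) ^ m) = A := fun A ↦ by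
      rw [hψ, coeff_psi_rename_castSucc_mul_X_last_pow, if_pos rfl]
    -- (1) `ψ(V) = S₃^{k-m}`
    have hVmap : V.map ψ = homogeneousSubmodule (Fin 3) ℂ (k - m) := by
      refine le_antisymm ?_ ?_
      · rintro _ ⟨P, ⟨-, hPk⟩, rfl⟩
        change ψ P ∈ homogeneousSubmodule (Fin 3) ℂ (k - m)
        rw [mem_homogeneousSubmodule, hψ]
        exact isHomogeneous_coeff_psi ((mem_homogeneousSubmodule k P).mp hPk) m
      · intro A hA
        exact ⟨_, ⟨hsecE A, hsecS A hA⟩, hψsec A⟩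
    -- (2) `ψ(W) = J_f^{k-m}`
    have hWmap : W.map ψ = idealDegree Jf (k - m) := by
      refine le_antisymm ?_ ?_
      · rintro _ ⟨P, ⟨-, hPJ, hPk⟩, rfl⟩
        refine ⟨?_, ?_⟩
        · rw [hψ]
          exact coeff_psi_mem_jacobianIdeal hm1 hPJ
        · change ψ P ∈ homogeneousSubmodule (Fin 3) ℂ (k - m)
          rw [mem_homogeneousSubmodule, hψ]
          exact isHomogeneous_coeff_psi ((mem_homogeneousSubmodule k P).mp hPk) m
      · rintro A ⟨hAJ, hAk⟩
        refine ⟨_, ⟨hsecE A, ?_, hsecS A hAk⟩, hψsec A⟩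
        exact Ideal.mul_mem_right _ _ (rename_castSucc_mem_jacobianIdeal p hAJ)
    -- (3) the two restrictions of `ψ` have the same kernel
    have hker : V ⊓ LinearMap.ker ψ = W ⊓ LinearMap.ker ψ := by
      refine le_antisymm ?_ (inf_le_inf_right _ hWV)
      rintro P ⟨⟨hPE, hPk⟩, hPker⟩
      refine ⟨⟨hPE, ?_, hPk⟩, hPker⟩
      rw [SetLike.mem_coe, mem_eigenspace_twistedDiagonalAction_iff] at hPE
      have h0 : ψ P = 0 := LinearMap.mem_ker.mp hPker
      change P ∈ JF
      rw [as_sum P]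
      refine Ideal.sum_mem _ fun e he ↦ monomial_mem_jacobianIdeal_of_le (by omega) f ?_ _
      refine le_last_of_diagonalCharacter_eq hp hip (hPE e he) fun heq ↦ ?_
      have hem : e (Fin.last 3) = m := by omega
      have hcoef : coeff e P = 0 := by
        rw [coeff_eq_coeff_psi_coeff, hem, ← hψ, h0, coeff_zero]
      exact (mem_support_iff.mp he) hcoef
    -- (4) rank–nullity
    have rV := finrank_map_add_finrank_inf_ker ψ V
    have rW := finrank_map_add_finrank_inf_ker ψ W
    rw [hker, hVmap] at rV
    rw [hWmap] at rW
    -- re-elaborate the dimension statements in one context, so that `omega` sees identical atoms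
    have d1 : Module.finrank ℂ ↥(homogeneousSubmodule (Fin 3) ℂ (k - m)) +
        Module.finrank ℂ ↥(W ⊓ LinearMap.ker ψ) = Module.finrank ℂ ↥V := rV
    have d2 : Module.finrank ℂ ↥(idealDegree Jf (k - m)) +
        Module.finrank ℂ ↥(W ⊓ LinearMap.ker ψ) = Module.finrank ℂ ↥W := rW
    have goal : Module.finrank ℂ ↥V - Module.finrank ℂ ↥W =
        Module.finrank ℂ ↥(homogeneousSubmodule (Fin 3) ℂ (k - m)) -
          Module.finrank ℂ ↥(idealDegree Jf (k - m)) := by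
      clear rV rW
      omega
    rw [hkm]
    exact goal

end Summit.HodgeConjecture.HodgeConjecture.Theorems.CyclicUnitaryPowersJacobianEigenpartsCount

end
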